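import Literature.AlgebraicGeometry.HodgeTheory.DirectImageEndomorphism
import Literature.AlgebraicGeometry.HodgeTheory.DirectImageTransport
import Literature.AlgebraicGeometry.HodgeTheory.FibrewiseDeckRelations
import Literature.AlgebraicGeometry.HodgeTheory.AlgebraicMonodromyMumfordTate
import Literature.AlgebraicGeometry.HodgeTheory.MonodromyMumfordTateHeredity
import Literature.AlgebraicGeometry.HodgeTheory.HodgeGenericTypeStabilityOfGenericPoint
import Literature.AlgebraicGeometry.HodgeTheory.QbarFamilyLocalSystem
import Literature.AlgebraicGeometry.HodgeTheory.BettiUniverseKunnethHodgePowersNormalForm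
import Literature.AlgebraicGeometry.HodgeTheory.BettiUniverseTracePairing
import Literature.AlgebraicGeometry.HodgeTheory.BettiUniverseAxioms
import Literature.AlgebraicGeometry.HodgeTheory.MotivatedClassesDeformationInputs
import Literature.AlgebraicGeometry.HodgeTheory.DivisorClassesFiniteEtaleBaseChange
import Literature.AlgebraicGeometry.HodgeTheory.QuaternionicQuarticFamily
import Literature.AlgebraicGeometry.HodgeTheory.QuaternionicQuarticDeckChart
import Literature.AlgebraicGeometry.HodgeTheory.QuaternionicQuarticDeckChartAction
import Literature.AlgebraicGeometry.HodgeTheory.HodgeFiltrationModelsReductionProofs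
import Literature.AlgebraicGeometry.HodgeTheory.ComplexConjugationHolds
import Literature.AlgebraicGeometry.Motives.HodgeTensorFactsHolds
import Summits.HodgeConjecture.HodgeConjecture.Theorems.Q8SymplecticPowersTransportClausesAlgebra
import HarnessLib

/-!
# Route `Q8SymplecticPowers`, crux K1Q — (δ) BASE-POINT TRANSPORT GLUE for stub S4 `stub_transcendentalQuaternionicPartQ`

Support file for crux K1Q `VeryGeneralQuaternionCommutatorsInHg` (stmt-HodgeConjecture-24190; `--supports … --as helper`; nothing here
closes an item). Prover seat `hodge-nonav-19716-p2` (g14); target (δ) named by planner p3 (g37, 2026-08-29 14:19∕14:31Z): the S4₄ closer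
obtains the clauses (ii) `6 ≤ dim Miv`, ((iii)) «`Miv` is irreducible under every finite-index subgroup of the monodromy group» and (iv)
`N ≤ ker((τ_s^*)² − 1)` of `stub_transcendentalQuaternionicPartQ` (skeleton «mechanism-v6∕v7», l.100) only at ONE member `s₀` of the
`Q`-family (where the flat-span certificate lives); S4 is `∀ s`. This file supplies the transport `s₀ ⇝ s`.

## Contents

* §1 = `Q8SymplecticPowersTransportClausesAlgebra` (imported; pure linear algebra): the abstract transport theorem `transport_clauses` —
  for `T : V₀ ≃ V₁` intertwining `A₀, A₁`, scaling the forms `Q₀, Q₁` in both directions and conjugating `Γ₀` onto `Γ₁`, the clauses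
  (ii) ∧ ((iii)) ∧ (iv), with `N, Mv, Miv` given by their defining equations, pass from the `0`-side to the `1`-side.
* §2 (the family) `transport_pull_fiberOverEnd` — rational transport along ANY path class commutes with the fibre maps of an
  endomorphism over the base (`transportFun_map_fiberHom`, Voisin II §3.1.2); `exists_tr_cup_transport_eq` — for a smooth projective
  family of surfaces, `tr(T x ∪ T y) = d · tr(x ∪ y)` for the rational transports `T` (degree 2), `T₄` (degree 4) along one path class
  (transport is multiplicative, `transportFun_cupProduct`, and `H⁴` of a fibre is a line, `finrank_bettiCohomology_top`).
* §3 `transcendentalPart_clauses_transport` — **(δ)** in the exact `let`-currency of `stub_transcendentalQuaternionicPartQ` (v6∕v7):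
  under the S6 package binders, for `s₀, s ∈ W(ℂ)`: `[(ii) ∧ ((iii)) ∧ (iv) at s₀] → [(ii) ∧ ((iii)) ∧ (iv) at s]`. Proof: `W(ℂ)` is path
  connected (irreducible smooth base: `connectedSpace_complexPoints_of_irreducibleSpace`,
  `pathConnectedSpace_complexPoints_of_smoothOfRelativeDimension`); rational transports along a path class `δ : s₀ ⇝ s` exist in
  degrees 2 and 4 (Ehresmann, `isRationalClass_transportFun_univ`, `exists_ratTransport`); they intertwine `τ_{s₀}^*`, `τ_s^*` (§2),
  conjugate `Γ_{s₀}` onto `Γ_s` (`conj_mem_ratMonodromyGroup_of_isRatTransport` and its `symm` form) and scale `tr ∘ cup` (§2, both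
  directions); then §1.

The Hodge-number clauses (o), (o′), (i) of S4 are NOT transported here (they are not topological; they follow at every `s` from the
local constancy of the Hodge numbers of a flat splitting, `SubvariationHodgeNumbersConstant`). HONEST FRAMING: linear-algebraic and
topological bookkeeping; K1Q is NOT proved; nothing here bears on HC ∕ HC_AV.

## References
* [VoisinHodgeII2003] C. Voisin, *Hodge Theory and Complex Algebraic Geometry II*, CUP 2003, §3.1.2 (local systems, transport,
  monodromy at path-joined points).
* [CarlsonMullerStachPeters2017] J. Carlson, S. Müller-Stach, C. Peters, *Period Mappings and Period Domains*, 2nd ed. (2017),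
  Lemma–Definition 15.3.7.
* [HatcherAT2002] A. Hatcher, *Algebraic Topology* (2002), §3.2 Prop. 3.10 (naturality of cup), §3.3 Cor. 3.37 (`H^{2n}` of a closed
  connected oriented manifold).
-/

noncomputable section

set_option linter.dupNamespace false
set_option maxHeartbeats 800000

namespace Summit.HodgeConjecture.HodgeConjecture.Theorems.Q8SymplecticPowersTranscendentalPartTransport

open scoped TensorProduct
open Summit.HodgeConjecture.HodgeConjecture.Theorems.Q8SymplecticPowersTransportClausesAlgebra
open CategoryTheory CategoryTheory.Limits AlgebraicGeometry
open Literature.AlgebraicGeometry.Motives Literature.AlgebraicGeometry.HodgeTheory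
open Literature.AlgebraicGeometry.HodgeTheory.BettiUniverse Literature.AlgebraicGeometry.HodgeTheory.Q8Family
open Literature.AlgebraicTopology.SingularHomology

/-! ### §2 The family: transports intertwine the deck maps and scale the trace form -/

section Family

/-- **Rational transport along a path class commutes with the fibre maps of an endomorphism over the base.** `π : 𝒳 ⟶ S`
cohomologically locally trivial over `S(ℂ)` (`hU`), `τ : 𝒳 ⟶ 𝒳` with `τ ≫ π = π`, `T` the rational transport of `Rᵏ π_* ℚ` along
`δ : a ⇝ b`. Then `T ∘ τ_a^* = τ_b^* ∘ T` (`transportFun_map_fiberHom` read through the injective complexification `ofRatClass`).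
[cite: VoisinHodgeII2003, §3.1.2] -/
theorem transport_pull_fiberOverEnd {𝒳 S : SchemeOver ℂ} (π : 𝒳 ⟶ S) (k : ℕ)
    (hU : IsCohomologicallyLocallyTrivialOn π (Set.univ : Set (ComplexPoints S))) (τ : 𝒳 ⟶ 𝒳) (hτ : τ ≫ π = π)
    {a b : (Set.univ : Set (ComplexPoints S))} {δ : Path.Homotopic.Quotient a b}
    {T : bettiCohomology (fiberOver π a.1) k ≃ₗ[ℚ] bettiCohomology (fiberOver π b.1) k}
    (hT : IsRatTransport π k hU δ T) (x : bettiCohomology (fiberOver π a.1) k) :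
    T (pull (fiberOverEnd π τ hτ a.1) k x) = pull (fiberOverEnd π τ hτ b.1) k (T x) := by
  apply ofRatClass_injective
  rw [hT, ofRatClass_pull, ofRatClass_pull, hT]
  exact transportFun_map_fiberHom π k hU τ hτ (fun t => fiberOverEnd π τ hτ t)
    (fun t => fiberOverEnd_comp_fiberι π τ hτ t) δ _

/-- **Transport scales the trace form of a family of surfaces.** `π : 𝒳 ⟶ S` a smooth projective family of surfaces,
cohomologically locally trivial over `S(ℂ)`; `T`, `T₄` the rational transports in degrees `2` and `4` along one path class
`δ : a ⇝ b`. Then for some `d ∈ ℚ`: `tr(T x ∪ T y) = d · tr(x ∪ y)` for all `x, y ∈ H²(X_a; ℚ)` — transport is multiplicative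
(`T x ∪ T y = T₄ (x ∪ y)`, `transportFun_cupProduct`) and `H⁴(X_a; ℚ)` is a line (`finrank_bettiCohomology_top`), on which
`tr_b ∘ T₄` is a multiple of `tr_a`. [cite: VoisinHodgeII2003, §3.1.2] [cite: HatcherAT2002, §3.2 Prop. 3.10 and §3.3 Cor. 3.37] -/
theorem exists_tr_cup_transport_eq {𝒳 S : SchemeOver ℂ} (π : 𝒳 ⟶ S) (hπ : IsSmoothProjectiveFamily π 2)
    (hU : IsCohomologicallyLocallyTrivialOn π (Set.univ : Set (ComplexPoints S)))
    {a b : (Set.univ : Set (ComplexPoints S))} {δ : Path.Homotopic.Quotient a b}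
    {T : bettiCohomology (fiberOver π a.1) 2 ≃ₗ[ℚ] bettiCohomology (fiberOver π b.1) 2}
    (hT : IsRatTransport π 2 hU δ T)
    {T₄ : bettiCohomology (fiberOver π a.1) (2 + 2) ≃ₗ[ℚ] bettiCohomology (fiberOver π b.1) (2 + 2)}
    (hT₄ : IsRatTransport π (2 + 2) hU δ T₄) :
    ∃ d : ℚ, ∀ x y : bettiCohomology (fiberOver π a.1) 2,
      tr (hπ.isSmoothProjective b.1) (2 + 2) (cup (fiberOver π b.1) 2 2 (T x) (T y)) =
        d * tr (hπ.isSmoothProjective a.1) (2 + 2) (cup (fiberOver π a.1) 2 2 x y) := by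
  classical
  have hXa : IsSmoothProjective 2 (fiberOver π a.1) := hπ.isSmoothProjective a.1
  haveI := finite hXa (2 * 2)
  -- multiplicativity: `T x ∪ T y = T₄ (x ∪ y)`
  have hmul : ∀ x y : bettiCohomology (fiberOver π a.1) 2,
      cup (fiberOver π b.1) 2 2 (T x) (T y) = T₄ (cup (fiberOver π a.1) 2 2 x y) := by
    intro x y
    apply ofRatClass_injective
    change ofRatClass _ (2 + 2) (bettiCup rfl (T x) (T y)) = _
    rw [ofRatClass_bettiCup, hT, hT, hT₄, ← transportFun_cupProduct π hU rfl δ]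
    change _ = transportFun π (2 + 2) hU δ (ofRatClass _ (2 + 2) (bettiCup rfl x y))
    rw [ofRatClass_bettiCup]
  -- the line `H⁴(X_a; ℚ)` and the scalar `d`
  have h1 : Module.finrank ℚ (bettiCohomology (fiberOver π a.1) (2 * 2)) = 1 := finrank_bettiCohomology_top hXa
  set e : bettiCohomology (fiberOver π a.1) (2 * 2) := lineBasis hXa (2 * 2) h1 0 with he
  have hline : ∀ w : bettiCohomology (fiberOver π a.1) (2 * 2), w = tr hXa (2 * 2) w • e := by
    intro w
    have hsum := (lineBasis hXa (2 * 2) h1).sum_repr w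
    rw [Fin.sum_univ_one] at hsum
    rw [tr_of_finrank_eq_one hXa h1, Module.Basis.coord_apply]
    exact hsum.symm
  have htr : ∀ w : bettiCohomology (fiberOver π a.1) (2 * 2),
      tr (hπ.isSmoothProjective b.1) (2 * 2) (T₄ w) =
        tr (hπ.isSmoothProjective b.1) (2 * 2) (T₄ e) * tr hXa (2 * 2) w := by
    intro w
    conv_lhs => rw [hline w, map_smul, map_smul]
    rw [smul_eq_mul, mul_comm]
  refine ⟨tr (hπ.isSmoothProjective b.1) (2 + 2) (T₄ e), fun x y => ?_⟩
  rw [hmul]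
  exact htr (cup (fiberOver π a.1) 2 2 x y)

end Family

/-! ### §3 (δ): the clauses (ii), ((iii)), (iv) of `stub_transcendentalQuaternionicPartQ` are transported along the base -/

/-- **(δ) BASE-POINT TRANSPORT for S4** — in the exact `let`-currency of `stub_transcendentalQuaternionicPartQ` (skeleton
«mechanism-v6∕v7» l.100; the S6 package binders `W 𝒳 π τ j ι` + clauses, `hU`): for `s₀, s ∈ W(ℂ)`,
`[(ii) ∧ ((iii)) ∧ (iv) at s₀] → [(ii) ∧ ((iii)) ∧ (iv) at s]`. `W(ℂ)` is path connected (irreducible smooth base); the rational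
transports `T` (degree 2) and `T₄` (degree 4) along a path class `s₀ ⇝ s` intertwine `τ_{s₀}^*` and `τ_s^*`
(`transport_pull_fiberOverEnd`), conjugate `Γ_{s₀}` onto `Γ_s` (`conj_mem_ratMonodromyGroup_of_isRatTransport`), and scale
`tr ∘ cup` in both directions (`exists_tr_cup_transport_eq`); conclude by `transport_clauses`.
[cite: VoisinHodgeII2003, §3.1.2] [cite: CarlsonMullerStachPeters2017, Lemma–Definition 15.3.7] -/
theorem transcendentalPart_clauses_transport :
    open Literature.AlgebraicGeometry.Motives Literature.AlgebraicGeometry.HodgeTheory Literature.AlgebraicGeometry.HodgeTheory.BettiUniverse Literature.AlgebraicGeometry.HodgeTheory.Q8Family Literature.AlgebraicGeometry.RelativeSpec Literature.AlgebraicGeometry.RelativeSpec.ActionOver CategoryTheory CategoryTheory.Limits MonoidalCategory CartesianMonoidalCategory AlgebraicGeometry in ∀ ⦃e : ℕ⦄, Even e → 4 ≤ e → ∀ (W : (Spec (.of (ParamRing e))).Opens) (𝒳 : SchemeOver ℂ) (π : 𝒳 ⟶ base W) (τ j : 𝒳 ⟶ 𝒳) (ι : (deckChart (fun i => (MvPolynomial.X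 i : ParamRing e)) ⊗ Over.mk W.ι).left ⟶ 𝒳.left), Nonempty (ComplexPoints (base W)) → ∀ (hπ : IsSmoothProjectiveFamily π 2), IsQuasiProjectiveOver 𝒳 → IsQuasiProjectiveOver (base W) → AlgebraicGeometry.SmoothOfRelativeDimension (Fintype.card (CIdx e)) (base W).hom → ∀ (hτπ : τ ≫ π = π) (hjπ : j ≫ π = π), τ ≫ τ ≫ τ ≫ τ = 𝟙 𝒳 → j ≫ j = τ ≫ τ → τ ≫ j ≫ τ = j → IsOpenImmersion ι → ι ≫ π.left = (snd (deckChart (fun i => (MvPolynomial.X i : ParamRing e))) (Over.mk W.ι)).left → ((Over.isoMk ((deckAction (fun i => (MvPolynomial.X i : ParamRing e))).aut (QuaternionGroup.a 1)) ((deckAction (fun i => (MvPolynomial.X i : ParamRing e))).aut_comp (QuaternionGroup.a 1))).hom ▷ Over.mk W.ι).left ≫ ι = ι ≫ τ.left → ((Over.isoMk ((deckAction (fun i => (MvPolynomial.X i : ParamRing e))).aut (QuaternionGroup.xa 0)) ((deckAction (fun i => (MvPolynomial.X i : ParamRing e))).aut_comp (QuaternionGroup.xa 0))).hom ▷ Over.mk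 W.ι).left ≫ ι = ι ≫ j.left → Function.Surjective (snd (deckChart (fun i => (MvPolynomial.X i : ParamRing e))) (Over.mk W.ι)).left → ∀ (hU : IsCohomologicallyLocallyTrivialOn π Set.univ) (s₀ s : ComplexPoints (base W)), (let Xs := fiberOver π s₀; let hXs : IsSmoothProjective 2 Xs := hπ.isSmoothProjective s₀; let A : bettiCohomology Xs 2 →ₗ[ℚ] bettiCohomology Xs 2 := pull (fiberOverEnd π τ hτπ s₀) 2; let Qf : LinearMap.BilinForm ℚ (bettiCohomology Xs 2) := LinearMap.compr₂ (cup Xs 2 2) (tr hXs (2 + 2)); let Γ := ratMonodromyGroup π 2 hU ⟨s₀, Set.mem_univ s₀⟩; let N : Submodule ℚ (bettiCohomology Xs 2) := Submodule.span ℚ {x | ∃ Γ' : Subgroup (bettiCohomology Xs 2 ≃ₗ[ℚ] bettiCohomology Xs 2), Γ' ≤ Γ ∧ (Γ'.subgroupOf Γ).FiniteIndex ∧ ∀ γ ∈ Γ', γ x = x}; let Mv : Submodule ℚ (bettiCohomology Xs 2) := Module.End.eigenspace (A ^ 2) (-1) ⊓ Qf.orthogonal N; let Miv : Submodule ℂ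 (TensorProduct ℚ ℂ (bettiCohomology Xs 2)) := Mv.baseChange ℂ ⊓ Module.End.eigenspace (A.baseChange ℂ) Complex.I; 6 ≤ Module.finrank ℂ Miv ∧ (∀ Γ' : Subgroup (bettiCohomology Xs 2 ≃ₗ[ℚ] bettiCohomology Xs 2), Γ' ≤ Γ → (Γ'.subgroupOf Γ).FiniteIndex → ∀ F : Submodule ℂ (TensorProduct ℚ ℂ (bettiCohomology Xs 2)), F ≤ Miv → (∀ γ ∈ Γ', ∀ x ∈ F, (γ.toLinearMap.baseChange ℂ) x ∈ F) → F = ⊥ ∨ F = Miv) ∧ N ≤ Module.End.eigenspace (A ^ 2) 1) → (let Xs := fiberOver π s; let hXs : IsSmoothProjective 2 Xs := hπ.isSmoothProjective s; let A : bettiCohomology Xs 2 →ₗ[ℚ] bettiCohomology Xs 2 := pull (fiberOverEnd π τ hτπ s) 2; let Qf : LinearMap.BilinForm ℚ (bettiCohomology Xs 2) := LinearMap.compr₂ (cup Xs 2 2) (tr hXs (2 + 2)); let Γ := ratMonodromyGroup π 2 hU ⟨s, Set.mem_univ s⟩; let N : Submodule ℚ (bettiCohomology Xs 2) := Submodule.span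 ℚ {x | ∃ Γ' : Subgroup (bettiCohomology Xs 2 ≃ₗ[ℚ] bettiCohomology Xs 2), Γ' ≤ Γ ∧ (Γ'.subgroupOf Γ).FiniteIndex ∧ ∀ γ ∈ Γ', γ x = x}; let Mv : Submodule ℚ (bettiCohomology Xs 2) := Module.End.eigenspace (A ^ 2) (-1) ⊓ Qf.orthogonal N; let Miv : Submodule ℂ (TensorProduct ℚ ℂ (bettiCohomology Xs 2)) := Mv.baseChange ℂ ⊓ Module.End.eigenspace (A.baseChange ℂ) Complex.I; 6 ≤ Module.finrank ℂ Miv ∧ (∀ Γ' : Subgroup (bettiCohomology Xs 2 ≃ₗ[ℚ] bettiCohomology Xs 2), Γ' ≤ Γ → (Γ'.subgroupOf Γ).FiniteIndex → ∀ F : Submodule ℂ (TensorProduct ℚ ℂ (bettiCohomology Xs 2)), F ≤ Miv → (∀ γ ∈ Γ', ∀ x ∈ F, (γ.toLinearMap.baseChange ℂ) x ∈ F) → F = ⊥ ∨ F = Miv) ∧ N ≤ Module.End.eigenspace (A ^ 2) 1) := by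
  intro e he h4 W 𝒳 π τ j ι hne hπ hqp hqpW hsm hτπ hjπ hτ4 hj2 hτjτ hιo hιπ hιτ hιj hsurj hU s₀ s h0 Xs hXs A Qf Γ N
    Mv Miv
  classical
  -- ### instances: Ehresmann (rational transports exist) and path-connectedness of `W(ℂ)`
  haveI := hπ.smoothOfRelativeDimension
  haveI := hπ.isProper
  haveI : LocallyOfFiniteType (base W).hom := hqpW.locallyOfFiniteType
  haveI : IsSeparated (base W).hom := hqpW.isVarietyPair_ofScheme.isSeparated
  haveI : QuasiCompact (base W).hom := hqpW.isVarietyPair_ofScheme.quasiCompact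
  haveI : CompactSpace (base W).left := QuasiCompact.compactSpace_of_compactSpace (base W).hom
  have hrat2 : ∀ (a b : (Set.univ : Set (ComplexPoints (base W)))) (γ : Path.Homotopic.Quotient a b)
      (α : complexBetti (fiberOver π a.1) 2), IsRationalClass α → IsRationalClass (transportFun π 2 hU γ α) :=
    fun a b γ α hα => isRationalClass_transportFun_univ (f := π) (k := 2) 2 (Fintype.card (CIdx e)) γ hα
  have hrat4 : ∀ (a b : (Set.univ : Set (ComplexPoints (base W)))) (γ : Path.Homotopic.Quotient a b)
      (α : complexBetti (fiberOver π a.1) (2 + 2)), IsRationalClass α →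
        IsRationalClass (transportFun π (2 + 2) hU γ α) :=
    fun a b γ α hα => isRationalClass_transportFun_univ (f := π) (k := 2 + 2) 2 (Fintype.card (CIdx e)) γ hα
  have hirr : IrreducibleSpace (base W).left := by
    obtain ⟨t₀⟩ := hne
    haveI : IrreducibleSpace (Spec (CommRingCat.of (ParamRing e))) :=
      inferInstanceAs (IrreducibleSpace (PrimeSpectrum (ParamRing e)))
    change IrreducibleSpace W
    exact isIrreducible_iff_irreducibleSpace.mp ⟨⟨W.ι t₀.pt, by rw [← Scheme.Opens.range_ι]; exact ⟨t₀.pt, rfl⟩⟩,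
      (PreirreducibleSpace.isPreirreducible_univ (X := Spec (CommRingCat.of (ParamRing e)))).open_subset W.isOpen
        (Set.subset_univ _)⟩
  haveI : ConnectedSpace (ComplexPoints (base W)) := connectedSpace_complexPoints_of_irreducibleSpace _
  haveI : PathConnectedSpace (ComplexPoints (base W)) :=
    pathConnectedSpace_complexPoints_of_smoothOfRelativeDimension _ (Fintype.card (CIdx e))
  haveI : PathConnectedSpace (Set.univ : Set (ComplexPoints (base W))) :=
    isPathConnected_iff_pathConnectedSpace.mp isPathConnected_univ
  -- ### a path class `δ : s₀ ⇝ s` and the rational transports along it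
  let δ : Path.Homotopic.Quotient (⟨s₀, Set.mem_univ s₀⟩ : (Set.univ : Set (ComplexPoints (base W))))
      ⟨s, Set.mem_univ s⟩ := Path.Homotopic.Quotient.mk (PathConnectedSpace.somePath _ _)
  obtain ⟨T, hT⟩ : ∃ T : bettiCohomology (fiberOver π s₀) 2 ≃ₗ[ℚ] bettiCohomology (fiberOver π s) 2,
      IsRatTransport π 2 hU δ T := exists_ratTransport π 2 hU hrat2 δ
  obtain ⟨T₄, hT₄⟩ : ∃ T₄ : bettiCohomology (fiberOver π s₀) (2 + 2) ≃ₗ[ℚ] bettiCohomology (fiberOver π s) (2 + 2),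
      IsRatTransport π (2 + 2) hU δ T₄ := exists_ratTransport π (2 + 2) hU hrat4 δ
  -- ### the ingredients of `transport_clauses`
  have hA : ∀ x, T (pull (fiberOverEnd π τ hτπ s₀) 2 x) = A (T x) := fun x =>
    transport_pull_fiberOverEnd π 2 hU τ hτπ hT x
  have hΓ₀ : ∀ g ∈ ratMonodromyGroup π 2 hU ⟨s₀, Set.mem_univ s₀⟩, T.symm.trans (g.trans T) ∈ Γ := fun g hg =>
    conj_mem_ratMonodromyGroup_of_isRatTransport π 2 hU hT hg
  have hΓ₁ : ∀ g ∈ Γ, T.trans (g.trans T.symm) ∈ ratMonodromyGroup π 2 hU ⟨s₀, Set.mem_univ s₀⟩ := fun g hg =>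
    conj_symm_mem_ratMonodromyGroup_of_isRatTransport π 2 hU hT hg
  obtain ⟨d, hd⟩ := exists_tr_cup_transport_eq π hπ hU hT hT₄
  obtain ⟨d', hd'⟩ := exists_tr_cup_transport_eq π hπ hU (hT.symm π 2 hU) (hT₄.symm π (2 + 2) hU)
  have hQ : ∀ x y, Qf (T x) (T y) =
      d * LinearMap.compr₂ (cup (fiberOver π s₀) 2 2) (tr (hπ.isSmoothProjective s₀) (2 + 2)) x y := fun x y =>
    (LinearMap.compr₂_apply _ _ _ _).trans ((hd x y).trans (by rw [LinearMap.compr₂_apply]))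
  have hQ' : ∀ x y, LinearMap.compr₂ (cup (fiberOver π s₀) 2 2) (tr (hπ.isSmoothProjective s₀) (2 + 2)) (T.symm x)
      (T.symm y) = d' * Qf x y := fun x y =>
    (LinearMap.compr₂_apply _ _ _ _).trans ((hd' x y).trans (by rw [LinearMap.compr₂_apply]))
  have key := transport_clauses T (pull (fiberOverEnd π τ hτπ s₀) 2) A hA
    (LinearMap.compr₂ (cup (fiberOver π s₀) 2 2) (tr (hπ.isSmoothProjective s₀) (2 + 2))) Qf d d' hQ hQ'
    (ratMonodromyGroup π 2 hU ⟨s₀, Set.mem_univ s₀⟩) Γ hΓ₀ hΓ₁ _ _ _ N Mv Miv rfl rfl rfl rfl rfl rfl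
  obtain ⟨hii, hiii, hiv⟩ := h0
  exact key ⟨hii, hiii, hiv⟩

end Summit.HodgeConjecture.HodgeConjecture.Theorems.Q8SymplecticPowersTranscendentalPartTransport

end
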